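import Summits.QuantumFields.YangMills.Theorems.BalabanUVNodesN15TwoSpacingGluingNeumannKnitEntryZero
import Summits.QuantumFields.YangMills.Theorems.BalabanUVNodesN15NeumannCubeRightEntries
import HarnessLib

/-!
# THE GLUING STEP AT TWO LATTICE SPACINGS, LII: THE ADJOINT REMAINDER ROW OF ONE NEUMANN CUBE OF THE COVER — `(M_{χ_k}G(□_k))∘[Δ_a, M_{h_k}] ≤ 1_{□_k}(y)·Θ_w·e^{−(δ_m∕2)|y−y′|_T}`
# ON THE DOUBLED TORUS AT ANY SPACING, FROM THE CUBE's SANDWICHED RIGHT ENTRIES (dag-n15-c g13, FILE 94; N15 = NE2, s1 «background-layer OPERATOR ingredient»)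

Cell `pub-ymgap`, seat `pub-ymgap-dag-n15-c` (R134 (a); HUMAN RULING D-0062), generation 13.  `bears_on: R4∕N15 · K3⁸ SpineGivenEndpointR13SepCoPHV (stmt-QuantumFields-27366)`
(KEY MAP v2).  Filed `--supports stmt-QuantumFields-27366 --as helper` — COUNT-NEUTRAL.  Theorems only (0 `def`, 0 `sorry`).  Imports BY NAME FILE 91 `…NeumannKnitEntryZero` (through it
FILES 45–80: `remainderL`, `comp_commOp_lapOp`, `hasMaj_comp_exp_out`, `hasMaj_commOp_nonlocal`, `hasMaj_nonlocalPart`, FILE 67's partition letters, FILE 70's cover) and dag-n15-a N-IIn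
`…N15NeumannCubeRightEntries` ((a)± `chiCube_neumannCubeG_comp_sD_mulOp` ∕ `chiCube_neumannCubeG_comp_bgrad_mulOp`); nothing in the tree is modified.

WHY.  FILE 50's bundle `GluedLetters` wants the adjoint remainder `R̃ = Σ_k M_{h_k}G(□_k)[Δ_a, M_{h_k}]` (FILE 49 `remainderL`) of the cover's parametrix at both spacings (rows 7, 8) and its
two-grid defect (row 14).  FILE 49's `hasMaj_comp_commOp_lapOp` needs two-sided rows of `G∘∇_μ`, `G∘∇⁻_μ`, which the images cube `G(□) = Sym∘G∘M_{χ°}` does not have (a derivative does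
not commute with the source cut); dag-n15-a N-IIn supplies them SANDWICHED: `G_□∘∇_μ∘M_g = T⁺_μ∘M_g`, `G_□∘∇⁻_μ∘M_g = T⁻_μ∘M_g` for multipliers `g` supported with their `∓e_μ`-translates in
the cube — and in `comp_commOp_lapOp` the right first-order entries only ever meet the coefficients `(∇_μh)∘e_μ⁻¹ = ∇⁻_μh`, `(∇⁻_μh)∘e_μ = ∇_μh`, supported in the transition layer of `h_k`,
i.e. inside `□_k` with its margin.

WHAT.  §1 ★ `remainderL_cut` (`M_hM_χ = M_h` ⟹ `remainderL Δ h (M_χ∘G) = remainderL Δ h G`), ★★ `hasMaj_comp_commOp_lapOp_of_sandwich` (FILE 49's adjoint (2.134) letter with the two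
first-order right entries replaced by the sandwich identities + two-sided rows of `T^±_μ`).  §2 pointwise bridges (`∇∇f = −(∇*∇f)∘e`, `(∇⁻f)∘e = ∇f`, `∇⁻∇f = −∇*∇f`, `(∇f)∘e⁻¹ = ∇⁻f`) and
the supports ★ `bgrad_coverH_support`, ★ `fgrad_coverH_support` (FILE 68∕73 `chiCube_coverCorner_eq_one_side`, `chi_eq_one_of_hcube_ne_zero`).  §3 ★ `loc₂_le_loc₁`, ★★★
**`hasMaj_chiCube_neumannCubeG_comp_commOp_deltaOp`**: on `M_ν = 2qw`, cube `□_k` (side `qw`, margin `m₀ + 2w + 1 ≤ qw`), any spacing `n`, from the torus letter of `G` (`C, δ₀`), two-sided rows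
of `T⁺_μ = χ∘Sym∘(G∘∇_μ)∘M_χ`, `T⁻_μ = −(χ∘Sym∘(G∘∇*_μ)∘M_χ)` (`β₁, δ₀`) and the letter of `∂Π∂*` (`C₁, δ₁`):
  `(M_{χ_k}∘G(□_k))∘[Δ_a, M_{h_k}] ≤ 1_{□_k}(y)·Θ_w·e^{−(δ_m∕2)d}`, `Θ_w = (d+1)(3β·32π²∕w² + 2β₁π∕w) + β·(ℓ(eδ_m∕4)⁻¹ + 2ω)c_N·c_r`, `β = 2^{d+1}Ce^{δ₀}`, `ℓ = ω = π(d+1)∕w`, `c_N = |a|e^{2δ_m} + C₁`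
— LOCAL part (§1 on `Δ_loc = Σ∇*∇`, FILE 67's `|∇^±h| ≤ π∕w`, `|∇*∇h| ≤ 32π²∕w²`, `W = 0`) + NONLOCAL part `(M_χG(□))∘[aQ*Q − ∂Π∂*, M_h]` (N-IIIb's two-sided cut row, FILE 56's commutator letter,
FILE 57 `hasMaj_comp_exp_out`): on the adjoint side the output cut is free, so NO margin split is needed (contrast FILE 69).  CONSUMER: the next file sums the cover (`R̃` at both spacings).

HONEST FRAMING ∕ LIMITS.  Lattice algebra + block-majorant bookkeeping over LANDED letters ([B5] (1.110), (1.126) via dag-n15-a; [B6] (2.91)–(2.93) p.239, (2.133)–(2.135) p.247 = SHAPES ∕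
MECHANISM, transposed); `U ≡ 1` doubled-cube torus MODEL (cube = half torus); nothing of [B5]∕[B6]∕[B9] asserted.  NE2⁺ NOT PRINTED, NOT proved; N15 NOT discharged; counts of record UNMOVED
(typed 28∕28 · discharged 5∕27); one finite 𝕋⁴ at fixed ε per index — NOT infinite volume, NOT OS on ℝ⁴, NOT a mass gap, NOT Clay; R4 closes `BalabanLadder.UV` only.  Restate-immune.
-/

noncomputable section

namespace Summit.QuantumFields.YangMills.BalabanUVNodes.N15.Gluing

open Real
open Literature.MathematicalPhysics.QuantumFieldTheory.Balaban1983to89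
open Literature.MathematicalPhysics.QuantumFieldTheory.Balaban1983to89.B5Prop11Plancherel (Tor fine unitVec)
open Literature.MathematicalPhysics.QuantumFieldTheory.Balaban1983to89.B11SectG (BlockNorm HasMaj RowSum hasMaj_zero)
open Literature.MathematicalPhysics.QuantumFieldTheory.Balaban1983to89.B6Prop26Gluing (mulOp mulOp_apply ind ind_nonneg ind_le_one)
open Literature.MathematicalPhysics.QuantumFieldTheory.Balaban1983to89.B6RandomWalk (Triangle254)
open Literature.MathematicalPhysics.QuantumFieldTheory.Balaban1983to89.B6UnitTorusCarrier (unitTorusGeo triangle254_unitTorusGeo rowSum_unitTorusGeo unitTorusGeo_dist_nonneg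
  unitTorusGeo_dist_self unitTorusGeo_dist_symm)
open Literature.MathematicalPhysics.QuantumFieldTheory.Balaban1983to89.B5SiteBridgeP12 (MP)
open Literature.MathematicalPhysics.QuantumFieldTheory.King1986.Torus (blockOf tdistT tdistT_nonneg)
open Summit.QuantumFields.YangMills.BalabanUVNodes.N15.VectorPiece (bshiftEquiv bshiftEquiv_apply bshiftEquiv_symm_apply kingPrV blkFine)
open Summit.QuantumFields.YangMills.BalabanUVNodes.N15.BackgroundLayer (fgrad fgradAdj bgrad fgrad_apply fgradAdj_apply bgrad_apply symbOp_sD_eq symbOp_sTinv_sub_one_eq)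
open Summit.QuantumFields.YangMills.BalabanUVNodes.N15.TwoGrid (paramsOf deltaOp gOp neumannCubeG symOp symbOp sD sTinv chiCube cubeBlocks landauRe qvRe qvAdjRe
  ineq110_114_pair hasMaj_gOp_of_ineq hasMaj_landauRe hasMaj_chiCube_symOp_comp hasMaj_comp_mulOp_chiInt chiCube_neumannCubeG_comp_sD_mulOp
  chiCube_neumannCubeG_comp_bgrad_mulOp hasMaj_rightGrad_pair hasMaj_rightBgrad_pair)

variable {d : ℕ}

/-! ## §1 The adjoint commutator piece from SANDWICHED right entries; the cut does not see the adjoint remainder -/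

section Generic

variable {X : Type} [Fintype X] {J : Type} [Fintype J] {K : Type} [Fintype K] {g : B6.Geometry} (blk : X → g.Site)

omit [Fintype X] [Fintype J] in
/-- ★ `M_{h_□}∘M_{χ_□} = M_{h_□}` ⟹ the adjoint remainder does not see the cut: `remainderL Δ h (M_χ∘G) = remainderL Δ h G`. [folklore] -/
theorem remainderL_cut {Δ : (X → ℝ) →ₗ[ℝ] (X → ℝ)} {h χ : K → X → ℝ} {G : K → (X → ℝ) →ₗ[ℝ] (X → ℝ)} (hcut : ∀ i, mulOp (h i) ∘ₗ mulOp (χ i) = mulOp (h i)) :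
    remainderL Δ h (fun i => mulOp (χ i) ∘ₗ G i) = remainderL Δ h G := by
  unfold remainderL
  refine Finset.sum_congr rfl fun i _ => ?_
  dsimp only
  rw [LinearMap.comp_assoc (commOp Δ (h i)) (G i) (mulOp (χ i)), ← LinearMap.comp_assoc (G i ∘ₗ commOp Δ (h i)) (mulOp (χ i)) (mulOp (h i)), hcut i]

/-- ★★ **THE ADJOINT (2.134) LETTER FROM SANDWICHED RIGHT ENTRIES** — FILE 49 `hasMaj_comp_commOp_lapOp` for a cube operator `G` whose right first-order entries are only available
SANDWICHED: `G∘∇_μ∘M_{a⁺_μ} = T⁺_μ∘M_{a⁺_μ}`, `G∘∇⁻_μ∘M_{a⁻_μ} = T⁻_μ∘M_{a⁻_μ}` for the two coefficients `a⁺_μ = (∇_μh)∘e_μ⁻¹`, `a⁻_μ = (∇⁻_μh)∘e_μ` that meet them in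
`comp_commOp_lapOp` (dag-n15-a N-IIn (a)±), with two-sided rows `G ≤ 1_S1_Sβe^{−δd}`, `T^±_μ ≤ 1_S1_Sβ₁e^{−δd}`, the partition letters `|∇^±h| ≤ c₁`, `|∇*∇h|, |∇∇h|, |∇⁻(∇⁻h∘e)| ≤ c₂` and
the `W`-letter `θ_W`: `G∘[Σ_μ∇*_μ∇_μ + W, M_h] ≤ 1_S1_S·(|J|(3βc₂ + 2β₁c₁) + θ_W)·e^{−δd}`. [cite: Balaban1984PropagatorsII, (2.133)–(2.134) p.247 (shapes + mechanism, transposed)] -/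
theorem hasMaj_comp_commOp_lapOp_of_sandwich {n : ℝ} {e : J → X ≃ X} {W G : (X → ℝ) →ₗ[ℝ] (X → ℝ)} {TD TB : J → (X → ℝ) →ₗ[ℝ] (X → ℝ)} {h : X → ℝ} {S : Set g.Site}
    {β β₁ c₁ c₂ θW δ : ℝ} (hβ : 0 ≤ β) (hβ₁ : 0 ≤ β₁) (hc₁ : 0 ≤ c₁) (hc₂ : 0 ≤ c₂)
    (hh1 : ∀ μ x, |fgrad n (e μ) h x| ≤ c₁) (hh1b : ∀ μ x, |bgrad n (e μ) h x| ≤ c₁) (hh2 : ∀ μ x, |fgradAdj n (e μ) (fgrad n (e μ) h) x| ≤ c₂)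
    (hh2f : ∀ μ x, |fgrad n (e μ) (fgrad n (e μ) h) x| ≤ c₂) (hh2b : ∀ μ x, |bgrad n (e μ) (bgrad n (e μ) h ∘ ⇑(e μ)) x| ≤ c₂)
    (hsD : ∀ μ, G ∘ₗ fgrad n (e μ) ∘ₗ mulOp (fgrad n (e μ) h ∘ ⇑(e μ).symm) = TD μ ∘ₗ mulOp (fgrad n (e μ) h ∘ ⇑(e μ).symm))
    (hsB : ∀ μ, G ∘ₗ bgrad n (e μ) ∘ₗ mulOp (bgrad n (e μ) h ∘ ⇑(e μ)) = TB μ ∘ₗ mulOp (bgrad n (e μ) h ∘ ⇑(e μ)))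
    (hG : HasMaj (BlockNorm.ofBlocks g blk) (BlockNorm.ofBlocks g blk) G (fun y y' => ind S y * ind S y' * (β * Real.exp (-(δ * g.dist y y')))))
    (hTD : ∀ μ, HasMaj (BlockNorm.ofBlocks g blk) (BlockNorm.ofBlocks g blk) (TD μ) (fun y y' => ind S y * ind S y' * (β₁ * Real.exp (-(δ * g.dist y y')))))
    (hTB : ∀ μ, HasMaj (BlockNorm.ofBlocks g blk) (BlockNorm.ofBlocks g blk) (TB μ) (fun y y' => ind S y * ind S y' * (β₁ * Real.exp (-(δ * g.dist y y')))))
    (hW : HasMaj (BlockNorm.ofBlocks g blk) (BlockNorm.ofBlocks g blk) (G ∘ₗ commOp W h) (fun y y' => ind S y * ind S y' * (θW * Real.exp (-(δ * g.dist y y'))))) :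
    HasMaj (BlockNorm.ofBlocks g blk) (BlockNorm.ofBlocks g blk) (G ∘ₗ commOp (lapOp n e W) h)
      (fun y y' => ind S y * ind S y' * ((Fintype.card J * (3 * (β * c₂) + 2 * (β₁ * c₁)) + θW) * Real.exp (-(δ * g.dist y y')))) := by
  have hterm : ∀ μ, HasMaj (BlockNorm.ofBlocks g blk) (BlockNorm.ofBlocks g blk)
      (G ∘ₗ mulOp (fgradAdj n (e μ) (fgrad n (e μ) h)) -
        ((G ∘ₗ fgrad n (e μ)) ∘ₗ mulOp (fgrad n (e μ) h ∘ ⇑(e μ).symm) - G ∘ₗ mulOp (fgrad n (e μ) (fgrad n (e μ) h) ∘ ⇑(e μ).symm)) -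
        ((G ∘ₗ bgrad n (e μ)) ∘ₗ mulOp (bgrad n (e μ) h ∘ ⇑(e μ)) - G ∘ₗ mulOp (bgrad n (e μ) (bgrad n (e μ) h ∘ ⇑(e μ)))))
      (fun y y' => ind S y * ind S y' * ((3 * (β * c₂) + 2 * (β₁ * c₁)) * Real.exp (-(δ * g.dist y y')))) := fun μ => by
    have t0 := hasMaj_comp_mulOp_loc blk hβ hc₂ (hh2 μ) hG
    have t1 : HasMaj (BlockNorm.ofBlocks g blk) (BlockNorm.ofBlocks g blk) ((G ∘ₗ fgrad n (e μ)) ∘ₗ mulOp (fgrad n (e μ) h ∘ ⇑(e μ).symm))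
        (fun y y' => ind S y * ind S y' * (β₁ * c₁ * Real.exp (-(δ * g.dist y y')))) := by
      rw [LinearMap.comp_assoc, hsD μ]
      exact hasMaj_comp_mulOp_loc blk hβ₁ hc₁ (abs_comp_le (⇑(e μ).symm) (hh1 μ)) (hTD μ)
    have t2 := hasMaj_comp_mulOp_loc blk hβ hc₂ (abs_comp_le (⇑(e μ).symm) (hh2f μ)) hG
    have t3 : HasMaj (BlockNorm.ofBlocks g blk) (BlockNorm.ofBlocks g blk) ((G ∘ₗ bgrad n (e μ)) ∘ₗ mulOp (bgrad n (e μ) h ∘ ⇑(e μ)))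
        (fun y y' => ind S y * ind S y' * (β₁ * c₁ * Real.exp (-(δ * g.dist y y')))) := by
      rw [LinearMap.comp_assoc, hsB μ]
      exact hasMaj_comp_mulOp_loc blk hβ₁ hc₁ (abs_comp_le (⇑(e μ)) (hh1b μ)) (hTB μ)
    have t4 := hasMaj_comp_mulOp_loc blk hβ hc₂ (hh2b μ) hG
    refine ((t0.sub (t1.sub t2)).sub (t3.sub t4)).mono fun y y' => le_of_eq ?_
    ring
  have hsum := hasMaj_fsum (b₁ := BlockNorm.ofBlocks g blk) (b₃ := BlockNorm.ofBlocks g blk) Finset.univ _ _ fun μ _ => hterm μ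
  rw [comp_commOp_lapOp]
  refine (hsum.add hW).mono fun y y' => le_of_eq ?_
  simp only [Finset.sum_const, Finset.card_univ, nsmul_eq_mul]
  ring

end Generic

/-! ## §2 Pointwise bridges for the partition's coefficients; their supports sit inside the cube together with their `±e_μ`-translates -/

section Bridges

variable {X : Type}

/-- `∇∇f = −(∇*∇f)∘e` pointwise. [folklore] -/
theorem fgrad_fgrad_apply_eq (n : ℝ) (e : X ≃ X) (f : X → ℝ) (x : X) : fgrad n e (fgrad n e f) x = -(fgradAdj n e (fgrad n e f) (e x)) := by
  simp only [fgrad_apply, fgradAdj_apply, Equiv.symm_apply_apply]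
  ring

/-- `(∇⁻f)∘e = ∇f`. [folklore] -/
theorem bgrad_comp_eq_fgrad (n : ℝ) (e : X ≃ X) (f : X → ℝ) : bgrad n e f ∘ ⇑e = fgrad n e f := by
  funext x
  simp only [Function.comp_apply, bgrad_apply, fgrad_apply, Equiv.symm_apply_apply]

/-- `∇⁻(∇f) = −∇*∇f` pointwise. [folklore] -/
theorem bgrad_fgrad_apply_eq (n : ℝ) (e : X ≃ X) (f : X → ℝ) (x : X) : bgrad n e (fgrad n e f) x = -(fgradAdj n e (fgrad n e f) x) := by
  simp only [bgrad_apply, fgradAdj_apply]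
  ring

/-- `(∇f)∘e⁻¹ = ∇⁻f`. [folklore] -/
theorem fgrad_comp_symm_eq_bgrad (n : ℝ) (e : X ≃ X) (f : X → ℝ) : fgrad n e f ∘ ⇑e.symm = bgrad n e f := by
  funext x
  simp only [Function.comp_apply, bgrad_apply, fgrad_apply, Equiv.apply_symm_apply]

end Bridges

section Support

variable {M : Fin (d + 1) → ℕ} [∀ μ, NeZero (M μ)] {n w q m₀ : ℕ} [NeZero n]

/-- ★ Where `∇⁻_μh_k ≠ 0` the bond's block and its `μ`-predecessor's block lie in the cube `□_k` ((a)⁺'s support hypothesis for the coefficient `(∇_μh_k)∘e_μ⁻¹ = ∇⁻_μh_k`). [folklore] -/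
theorem bgrad_coverH_support (hM : ∀ ν, M ν = 2 * q * w) (hw : 0 < w) (hfit : m₀ + 2 * w + 1 ≤ q * w) (μ : Fin (d + 1)) (k : Fin (d + 1) → ZMod (2 * q))
    (b : Tor (fine n M) × Fin (d + 1)) (hb : (fgrad (n : ℝ) (bshiftEquiv M n μ) (hcube (2 * q) (coverXi M n w) k) ∘ ⇑(bshiftEquiv M n μ).symm) b ≠ 0) :
    blockOf n M b.1 ∈ cubeBlocks M (coverCorner M w q m₀ k) (q * w) ∧ blockOf n M (b.1 - unitVec (fine n M) μ) ∈ cubeBlocks M (coverCorner M w q m₀ k) (q * w) := by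
  have hS : q * w ≤ 2 * q * w := by nlinarith
  have hχ := chiCube_coverCorner_eq_one_side (M := M) (n := n) (m₀ := m₀) hM hw hfit hS μ k
  have mem : ∀ x : Tor (fine n M) × Fin (d + 1), chiCube M n (coverCorner M w q m₀ k) (q * w) x = 1 →
      blockOf n M x.1 ∈ cubeBlocks M (coverCorner M w q m₀ k) (q * w) := fun x hx => by
    unfold chiCube at hx
    by_contra hb'
    rw [if_neg hb'] at hx
    exact zero_ne_one hx
  -- `h_k(b) ≠ h_k(e⁻¹ b)`: one of them is nonzero
  have hne : hcube (2 * q) (coverXi M n w) k b ≠ 0 ∨ hcube (2 * q) (coverXi M n w) k ((bshiftEquiv M n μ).symm b) ≠ 0 := by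
    by_contra h0
    push Not at h0
    apply hb
    simp only [Function.comp_apply, fgrad_apply, Equiv.apply_symm_apply, h0.1, h0.2, sub_self, mul_zero]
  have h2 : blockOf n M ((bshiftEquiv M n μ).symm b).1 = blockOf n M (b.1 - unitVec (fine n M) μ) := by rw [bshiftEquiv_symm_apply]
  rcases hne with h | h
  · refine ⟨mem b (chi_eq_one_of_hcube_ne_zero (2 * q) (coverXi M n w) (bshiftEquiv M n) μ hχ (Or.inl rfl) h), ?_⟩
    rw [← h2]
    exact mem _ (chi_eq_one_of_hcube_ne_zero (2 * q) (coverXi M n w) (bshiftEquiv M n) μ hχ (Or.inr (Or.inl ((bshiftEquiv M n μ).apply_symm_apply b).symm)) h)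
  · refine ⟨mem b (chi_eq_one_of_hcube_ne_zero (2 * q) (coverXi M n w) (bshiftEquiv M n) μ hχ (Or.inr (Or.inr rfl)) h), ?_⟩
    rw [← h2]
    exact mem _ (chi_eq_one_of_hcube_ne_zero (2 * q) (coverXi M n w) (bshiftEquiv M n) μ hχ (Or.inl rfl) h)

/-- ★ Where `∇_μh_k ≠ 0` the bond's block and its `μ`-successor's block lie in the cube `□_k` ((a)⁻'s support hypothesis for the coefficient `(∇⁻_μh_k)∘e_μ = ∇_μh_k`). [folklore] -/
theorem fgrad_coverH_support (hM : ∀ ν, M ν = 2 * q * w) (hw : 0 < w) (hfit : m₀ + 2 * w + 1 ≤ q * w) (μ : Fin (d + 1)) (k : Fin (d + 1) → ZMod (2 * q))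
    (b : Tor (fine n M) × Fin (d + 1)) (hb : (bgrad (n : ℝ) (bshiftEquiv M n μ) (hcube (2 * q) (coverXi M n w) k) ∘ ⇑(bshiftEquiv M n μ)) b ≠ 0) :
    blockOf n M b.1 ∈ cubeBlocks M (coverCorner M w q m₀ k) (q * w) ∧ blockOf n M (b.1 + unitVec (fine n M) μ) ∈ cubeBlocks M (coverCorner M w q m₀ k) (q * w) := by
  have hS : q * w ≤ 2 * q * w := by nlinarith
  have hχ := chiCube_coverCorner_eq_one_side (M := M) (n := n) (m₀ := m₀) hM hw hfit hS μ k
  have mem : ∀ x : Tor (fine n M) × Fin (d + 1), chiCube M n (coverCorner M w q m₀ k) (q * w) x = 1 →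
      blockOf n M x.1 ∈ cubeBlocks M (coverCorner M w q m₀ k) (q * w) := fun x hx => by
    unfold chiCube at hx
    by_contra hb'
    rw [if_neg hb'] at hx
    exact zero_ne_one hx
  have hne : hcube (2 * q) (coverXi M n w) k b ≠ 0 ∨ hcube (2 * q) (coverXi M n w) k (bshiftEquiv M n μ b) ≠ 0 := by
    by_contra h0
    push Not at h0
    apply hb
    simp only [Function.comp_apply, bgrad_apply, Equiv.symm_apply_apply, h0.1, h0.2, sub_self, mul_zero]
  have h2 : blockOf n M (bshiftEquiv M n μ b).1 = blockOf n M (b.1 + unitVec (fine n M) μ) := by rw [bshiftEquiv_apply]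
  rcases hne with h | h
  · refine ⟨mem b (chi_eq_one_of_hcube_ne_zero (2 * q) (coverXi M n w) (bshiftEquiv M n) μ hχ (Or.inl rfl) h), ?_⟩
    rw [← h2]
    exact mem _ (chi_eq_one_of_hcube_ne_zero (2 * q) (coverXi M n w) (bshiftEquiv M n) μ hχ (Or.inr (Or.inr ((bshiftEquiv M n μ).symm_apply_apply b).symm)) h)
  · refine ⟨mem b (chi_eq_one_of_hcube_ne_zero (2 * q) (coverXi M n w) (bshiftEquiv M n) μ hχ (Or.inr (Or.inl rfl)) h), ?_⟩
    rw [← h2]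
    exact mem _ (chi_eq_one_of_hcube_ne_zero (2 * q) (coverXi M n w) (bshiftEquiv M n) μ hχ (Or.inl rfl) h)

end Support

/-! ## §3 The adjoint remainder row of ONE cube of the cover, at any spacing, from the cube's right entries -/

section Cube

variable {M : Fin (d + 1) → ℕ} [∀ μ, NeZero (M μ)] {L kk n w q m₀ : ℕ} [NeZero n]

/-- Drop the input indicator and weaken the rate: `1_S(y)1_S(y′)·θe^{−δd} ≤ 1_S(y)·θe^{−δ′d}` (`θ ≥ 0`, `δ′ ≤ δ`, `d ≥ 0`). [folklore] -/
theorem loc₂_le_loc₁ {S : Set (Tor M)} {θ δ δ' : ℝ} (hθ : 0 ≤ θ) (hδ : δ' ≤ δ) (y y' : Tor M) :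
    ind (g := unitTorusGeo L kk M) S y * ind (g := unitTorusGeo L kk M) S y' * (θ * Real.exp (-(δ * tdistT M y y'))) ≤
      ind (g := unitTorusGeo L kk M) S y * (θ * Real.exp (-(δ' * tdistT M y y'))) := by
  have h1 := ind_le_one (g := unitTorusGeo L kk M) S y'
  have h0 := ind_nonneg (g := unitTorusGeo L kk M) S y
  have h0' := ind_nonneg (g := unitTorusGeo L kk M) S y'
  have hexp : Real.exp (-(δ * tdistT M y y')) ≤ Real.exp (-(δ' * tdistT M y y')) := Real.exp_le_exp.mpr (by nlinarith [tdistT_nonneg M y y'])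
  have hE := Real.exp_nonneg (-(δ * tdistT M y y'))
  calc ind (g := unitTorusGeo L kk M) S y * ind (g := unitTorusGeo L kk M) S y' * (θ * Real.exp (-(δ * tdistT M y y')))
      ≤ ind (g := unitTorusGeo L kk M) S y * 1 * (θ * Real.exp (-(δ * tdistT M y y'))) :=
        mul_le_mul_of_nonneg_right (mul_le_mul_of_nonneg_left h1 h0) (mul_nonneg hθ hE)
    _ ≤ ind (g := unitTorusGeo L kk M) S y * (θ * Real.exp (-(δ' * tdistT M y y'))) := by
        rw [mul_one]; exact mul_le_mul_of_nonneg_left (mul_le_mul_of_nonneg_left hexp hθ) h0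

/-- ★★★ **THE ADJOINT REMAINDER ROW OF ONE CUBE OF THE COVER**: on the doubled torus `M_ν = 2qw` (cube `□_k = c_k + [0, qw)^{d+1}`, margin `m₀ + 2w + 1 ≤ qw`), at any spacing `n`,
`(M_{χ_k}∘G(□_k))∘[Δ_a, M_{h_k}] ≤ 1_{□_k}(y)·Θ_w·e^{−(δ_m∕2)|y−y′|_T}` (`δ_m = min δ₀ δ₁`) — the OUTPUT-localized row FILE 57's `hasMaj_remainderL_out` consumes — from the torus letter of `G`
(`C, δ₀`: the two-sided cut row `M_χ∘G(□)` of N-IIIb), the SANDWICHED right entries `T⁺_μ = χ∘Sym∘(G∘∇_μ)∘M_χ`, `T⁻_μ = −(χ∘Sym∘(G∘∇*_μ)∘M_χ)` (`β₁, δ₀`; dag-n15-a N-IIn (a)±: `G_□∘∇_μ∘M_g =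
T⁺_μ∘M_g`, `G_□∘∇⁻_μ∘M_g = T⁻_μ∘M_g` for the coefficients `g = ∇⁻_μh_k, ∇_μh_k` — §2's supports) and the letter of `∂Π∂*` (`C₁, δ₁`): LOCAL part §1 `hasMaj_comp_commOp_lapOp_of_sandwich` with FILE 67's
`|∇^±h| ≤ π∕w`, `|∇*∇h| ≤ 32π²∕w²`; NONLOCAL part `(M_χG(□))∘[aQ*Q − ∂Π∂*, M_h]` = two-sided cut row after FILE 56's commutator letter (`hasMaj_commOp_nonlocal`, FILE 67's moduli `ℓ = ω =
π(d+1)∕w`), through FILE 57 `hasMaj_comp_exp_out` — NO margin split is needed on the adjoint side (the output cut is free).  `Θ_w = O(w⁻¹)`.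
[cite: Balaban1984PropagatorsII, (2.91)–(2.93) p.239, (2.133)–(2.135) p.247 (shapes + mechanism, transposed); Balaban1984PropagatorsI, (1.121)–(1.128) pp.37–38, p.39 («a representation of G
adjoint to (1.123)»)] -/
theorem hasMaj_chiCube_neumannCubeG_comp_commOp_deltaOp (hM : ∀ ν, M ν = 2 * q * w) (hw : 0 < w) (hfit : m₀ + 2 * w + 1 ≤ q * w) (k : Fin (d + 1) → ZMod (2 * q))
    {a C δ₀ C₁ δ₁ β₁ : ℝ} (ha : 0 < a) (hC : 0 < C) (hδ₀ : 0 < δ₀) (hC₁ : 0 ≤ C₁) (hδ₁ : 0 < δ₁) (hβ₁ : 0 ≤ β₁)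
    (hG : HasMaj (BlockNorm.ofBlocks (unitTorusGeo L kk M) (fun b : Tor (fine n M) × Fin (d + 1) => blockOf n M b.1))
      (BlockNorm.ofBlocks (unitTorusGeo L kk M) (fun b : Tor (fine n M) × Fin (d + 1) => blockOf n M b.1)) (gOp M n a) (fun y y' => C * Real.exp (-(δ₀ * tdistT M y y'))))
    (hTD : ∀ μ, HasMaj (BlockNorm.ofBlocks (unitTorusGeo L kk M) (fun b : Tor (fine n M) × Fin (d + 1) => blockOf n M b.1))
      (BlockNorm.ofBlocks (unitTorusGeo L kk M) (fun b : Tor (fine n M) × Fin (d + 1) => blockOf n M b.1))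
      (mulOp (chiCube M n (coverCorner M w q m₀ k) (q * w)) ∘ₗ symOp M n (coverCorner M w q m₀ k) ∘ₗ (gOp M n a ∘ₗ fgrad (n : ℝ) (bshiftEquiv M n μ)) ∘ₗ
        mulOp (chiCube M n (coverCorner M w q m₀ k) (q * w)))
      (fun y y' => ind ((cubeBlocks M (coverCorner M w q m₀ k) (q * w) : Finset (Tor M)) : Set (Tor M)) y *
        ind ((cubeBlocks M (coverCorner M w q m₀ k) (q * w) : Finset (Tor M)) : Set (Tor M)) y' * (β₁ * Real.exp (-(δ₀ * tdistT M y y')))))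
    (hTB : ∀ μ, HasMaj (BlockNorm.ofBlocks (unitTorusGeo L kk M) (fun b : Tor (fine n M) × Fin (d + 1) => blockOf n M b.1))
      (BlockNorm.ofBlocks (unitTorusGeo L kk M) (fun b : Tor (fine n M) × Fin (d + 1) => blockOf n M b.1))
      (-(mulOp (chiCube M n (coverCorner M w q m₀ k) (q * w)) ∘ₗ symOp M n (coverCorner M w q m₀ k) ∘ₗ (gOp M n a ∘ₗ fgradAdj (n : ℝ) (bshiftEquiv M n μ)) ∘ₗ
        mulOp (chiCube M n (coverCorner M w q m₀ k) (q * w))))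
      (fun y y' => ind ((cubeBlocks M (coverCorner M w q m₀ k) (q * w) : Finset (Tor M)) : Set (Tor M)) y *
        ind ((cubeBlocks M (coverCorner M w q m₀ k) (q * w) : Finset (Tor M)) : Set (Tor M)) y' * (β₁ * Real.exp (-(δ₀ * tdistT M y y')))))
    (hNL : HasMaj (BlockNorm.ofBlocks (unitTorusGeo L kk M) (fun b : Tor (fine n M) × Fin (d + 1) => blockOf n M b.1))
      (BlockNorm.ofBlocks (unitTorusGeo L kk M) (fun b : Tor (fine n M) × Fin (d + 1) => blockOf n M b.1)) (landauRe M n) (fun y y' => C₁ * Real.exp (-(δ₁ * tdistT M y y')))) :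
    HasMaj (BlockNorm.ofBlocks (unitTorusGeo L kk M) (fun b : Tor (fine n M) × Fin (d + 1) => blockOf n M b.1))
      (BlockNorm.ofBlocks (unitTorusGeo L kk M) (fun b : Tor (fine n M) × Fin (d + 1) => blockOf n M b.1))
      ((mulOp (chiCube M n (coverCorner M w q m₀ k) (q * w)) ∘ₗ neumannCubeG M n (coverCorner M w q m₀ k) (q * w) a) ∘ₗ
        commOp (deltaOp M n a) (hcube (2 * q) (coverXi M n w) k))
      (fun y y' => ind ((cubeBlocks M (coverCorner M w q m₀ k) (q * w) : Finset (Tor M)) : Set (Tor M)) y *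
        ((((d + 1 : ℕ) : ℝ) * (3 * (2 ^ (d + 1) * (C * Real.exp δ₀) * (32 * π ^ 2 / (w : ℝ) ^ 2)) + 2 * (β₁ * (π / w))) + 0 +
          2 ^ (d + 1) * (C * Real.exp δ₀) *
            ((π * (d + 1) / w * (Real.exp 1 * (min δ₀ δ₁ / 4))⁻¹ + 2 * (π * (d + 1) / w)) * (|a| * (Real.exp (min δ₀ δ₁) * Real.exp (min δ₀ δ₁)) + C₁)) *
            B4Sect5Proof.latticeConst (d + 1) (min δ₀ δ₁ / 4)) *
          Real.exp (-(min δ₀ δ₁ / 2 * tdistT M y y')))) := by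
  have hn : 1 ≤ n := Nat.one_le_iff_ne_zero.mpr (NeZero.ne n)
  have hM' : ∀ ν, M ν = 2 * (q * w) := fun ν => by rw [hM ν, mul_assoc]
  have hwR : (0 : ℝ) < w := by exact_mod_cast hw
  have hδm : 0 < min δ₀ δ₁ := lt_min hδ₀ hδ₁
  have hβ : (0 : ℝ) ≤ 2 ^ (d + 1) * (C * Real.exp δ₀) := by positivity
  have hc₁ : (0 : ℝ) ≤ π / w := by positivity
  have hc₂ : (0 : ℝ) ≤ 32 * π ^ 2 / (w : ℝ) ^ 2 := by positivity
  -- the two-sided row of the cut cube (N-IIIb)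
  have hGc : HasMaj (BlockNorm.ofBlocks (unitTorusGeo L kk M) (fun b : Tor (fine n M) × Fin (d + 1) => blockOf n M b.1))
      (BlockNorm.ofBlocks (unitTorusGeo L kk M) (fun b : Tor (fine n M) × Fin (d + 1) => blockOf n M b.1))
      (mulOp (chiCube M n (coverCorner M w q m₀ k) (q * w)) ∘ₗ neumannCubeG M n (coverCorner M w q m₀ k) (q * w) a)
      (fun y y' => ind ((cubeBlocks M (coverCorner M w q m₀ k) (q * w) : Finset (Tor M)) : Set (Tor M)) y *
        ind ((cubeBlocks M (coverCorner M w q m₀ k) (q * w) : Finset (Tor M)) : Set (Tor M)) y' * (2 ^ (d + 1) * (C * Real.exp δ₀) * Real.exp (-(δ₀ * tdistT M y y')))) :=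
    hasMaj_chiCube_symOp_comp (L := L) (k := kk) (c := coverCorner M w q m₀ k) (S := q * w) hC.le hδ₀.le hM'
      (hasMaj_comp_mulOp_chiInt (c := coverCorner M w q m₀ k) (S := q * w) hC.le hG)
  -- the partition letters (FILE 67) and their bridges
  have hh1 := fun μ x => abs_fgrad_coverH_le (n := n) hM hw k μ x
  have hh1b := fun μ x => abs_bgrad_coverH_le (n := n) hM hw k μ x
  have hh2 := fun μ x => abs_fgradAdj_fgrad_coverH_le (n := n) hM hw k μ x
  have hh2f : ∀ (μ : Fin (d + 1)) (x : Tor (fine n M) × Fin (d + 1)),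
      |fgrad (n : ℝ) (bshiftEquiv M n μ) (fgrad (n : ℝ) (bshiftEquiv M n μ) (hcube (2 * q) (coverXi M n w) k)) x| ≤ 32 * π ^ 2 / (w : ℝ) ^ 2 := fun μ x => by
    rw [fgrad_fgrad_apply_eq, abs_neg]; exact hh2 μ _
  have hh2b : ∀ (μ : Fin (d + 1)) (x : Tor (fine n M) × Fin (d + 1)),
      |bgrad (n : ℝ) (bshiftEquiv M n μ) (bgrad (n : ℝ) (bshiftEquiv M n μ) (hcube (2 * q) (coverXi M n w) k) ∘ ⇑(bshiftEquiv M n μ)) x| ≤ 32 * π ^ 2 / (w : ℝ) ^ 2 :=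
    fun μ x => by rw [bgrad_comp_eq_fgrad, bgrad_fgrad_apply_eq, abs_neg]; exact hh2 μ x
  -- the sandwich identities (dag-n15-a N-IIn (a)±) on the supports of §2
  have hsD : ∀ μ : Fin (d + 1), (mulOp (chiCube M n (coverCorner M w q m₀ k) (q * w)) ∘ₗ neumannCubeG M n (coverCorner M w q m₀ k) (q * w) a) ∘ₗ
      fgrad (n : ℝ) (bshiftEquiv M n μ) ∘ₗ mulOp (fgrad (n : ℝ) (bshiftEquiv M n μ) (hcube (2 * q) (coverXi M n w) k) ∘ ⇑(bshiftEquiv M n μ).symm) =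
      (mulOp (chiCube M n (coverCorner M w q m₀ k) (q * w)) ∘ₗ symOp M n (coverCorner M w q m₀ k) ∘ₗ (gOp M n a ∘ₗ fgrad (n : ℝ) (bshiftEquiv M n μ)) ∘ₗ
        mulOp (chiCube M n (coverCorner M w q m₀ k) (q * w))) ∘ₗ mulOp (fgrad (n : ℝ) (bshiftEquiv M n μ) (hcube (2 * q) (coverXi M n w) k) ∘ ⇑(bshiftEquiv M n μ).symm) :=
    fun μ => by
    have h := chiCube_neumannCubeG_comp_sD_mulOp (c := coverCorner M w q m₀ k) (S := q * w) hM' hn ha μ (fun b hb => bgrad_coverH_support hM hw hfit μ k b hb)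
    rw [symbOp_sD_eq] at h
    exact h
  have hsB : ∀ μ : Fin (d + 1), (mulOp (chiCube M n (coverCorner M w q m₀ k) (q * w)) ∘ₗ neumannCubeG M n (coverCorner M w q m₀ k) (q * w) a) ∘ₗ
      bgrad (n : ℝ) (bshiftEquiv M n μ) ∘ₗ mulOp (bgrad (n : ℝ) (bshiftEquiv M n μ) (hcube (2 * q) (coverXi M n w) k) ∘ ⇑(bshiftEquiv M n μ)) =
      (-(mulOp (chiCube M n (coverCorner M w q m₀ k) (q * w)) ∘ₗ symOp M n (coverCorner M w q m₀ k) ∘ₗ (gOp M n a ∘ₗ fgradAdj (n : ℝ) (bshiftEquiv M n μ)) ∘ₗ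
        mulOp (chiCube M n (coverCorner M w q m₀ k) (q * w)))) ∘ₗ mulOp (bgrad (n : ℝ) (bshiftEquiv M n μ) (hcube (2 * q) (coverXi M n w) k) ∘ ⇑(bshiftEquiv M n μ)) :=
    fun μ => by
    have h := chiCube_neumannCubeG_comp_bgrad_mulOp (c := coverCorner M w q m₀ k) (S := q * w) hM' hn ha μ (fun b hb => fgrad_coverH_support hM hw hfit μ k b hb)
    rw [symbOp_sTinv_sub_one_eq, ← LinearMap.neg_comp] at h
    exact h
  -- the `W = 0` letter
  have hW : HasMaj (BlockNorm.ofBlocks (unitTorusGeo L kk M) (fun b : Tor (fine n M) × Fin (d + 1) => blockOf n M b.1))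
      (BlockNorm.ofBlocks (unitTorusGeo L kk M) (fun b : Tor (fine n M) × Fin (d + 1) => blockOf n M b.1))
      ((mulOp (chiCube M n (coverCorner M w q m₀ k) (q * w)) ∘ₗ neumannCubeG M n (coverCorner M w q m₀ k) (q * w) a) ∘ₗ
        commOp (0 : (Tor (fine n M) × Fin (d + 1) → ℝ) →ₗ[ℝ] (Tor (fine n M) × Fin (d + 1) → ℝ)) (hcube (2 * q) (coverXi M n w) k))
      (fun y y' => ind ((cubeBlocks M (coverCorner M w q m₀ k) (q * w) : Finset (Tor M)) : Set (Tor M)) y *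
        ind ((cubeBlocks M (coverCorner M w q m₀ k) (q * w) : Finset (Tor M)) : Set (Tor M)) y' * (0 * Real.exp (-(δ₀ * tdistT M y y')))) := by
    rw [commOp_zero_left, LinearMap.comp_zero]
    exact (hasMaj_zero _ _).mono fun y y' => le_of_eq (by ring)
  -- THE LOCAL PART (§1)
  have hloc := hasMaj_comp_commOp_lapOp_of_sandwich (g := unitTorusGeo L kk M) (fun b : Tor (fine n M) × Fin (d + 1) => blockOf n M b.1)
    (S := ((cubeBlocks M (coverCorner M w q m₀ k) (q * w) : Finset (Tor M)) : Set (Tor M))) hβ hβ₁ hc₁ hc₂ hh1 hh1b hh2 hh2f hh2b hsD hsB hGc hTD hTB hW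
  rw [Fintype.card_fin] at hloc
  -- THE NONLOCAL PART: the commutator letter of `N′ = aQ*Q − ∂Π∂*` behind the two-sided cut row
  have hN' := hasMaj_nonlocalPart (L := L) (kk := kk) (a := a) hC₁ hδm.le (min_le_right δ₀ δ₁) hNL
  have hcN : 0 ≤ |a| * (Real.exp (min δ₀ δ₁) * Real.exp (min δ₀ δ₁)) + C₁ := by positivity
  have h1 := hasMaj_commOp_nonlocal (g := unitTorusGeo L kk M) (fun b : Tor (fine n M) × Fin (d + 1) => blockOf n M b.1) (h := hcube (2 * q) (coverXi M n w) k)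
    (hb := coverHb M n w q k) hcN (by positivity : (0 : ℝ) ≤ π * (d + 1) / w) (by positivity : (0 : ℝ) ≤ π * (d + 1) / w) (by positivity : (0 : ℝ) < min δ₀ δ₁ / 4)
    (unitTorusGeo_dist_nonneg L kk M) (unitTorusGeo_dist_symm L kk M) (fun y y' => abs_coverHb_sub_le hM hw k y y') (fun x => abs_coverH_sub_coverHb_le hM hw k x) hN'
  have hrow := rowSum_unitTorusGeo (L := L) (k := kk) (M := M) (σ := min δ₀ δ₁ / 4) (by positivity)
  have hcK : (0 : ℝ) ≤ (π * (d + 1) / w * (Real.exp 1 * (min δ₀ δ₁ / 4))⁻¹ + 2 * (π * (d + 1) / w)) * (|a| * (Real.exp (min δ₀ δ₁) * Real.exp (min δ₀ δ₁)) + C₁) := by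
    positivity
  have hnl := hasMaj_comp_exp_out (g := unitTorusGeo L kk M) (fun b : Tor (fine n M) × Fin (d + 1) => blockOf n M b.1) (triangle254_unitTorusGeo L kk M)
    (unitTorusGeo_dist_nonneg L kk M) hrow hβ hcK (by positivity : (0 : ℝ) ≤ min δ₀ δ₁ / 2) (by linarith : min δ₀ δ₁ / 2 ≤ min δ₀ δ₁ - min δ₀ δ₁ / 4)
    (by linarith [min_le_left δ₀ δ₁] : min δ₀ δ₁ / 2 + min δ₀ δ₁ / 4 ≤ δ₀) hGc h1
  -- THE SUM
  have hθloc : (0 : ℝ) ≤ ((d + 1 : ℕ) : ℝ) * (3 * (2 ^ (d + 1) * (C * Real.exp δ₀) * (32 * π ^ 2 / (w : ℝ) ^ 2)) + 2 * (β₁ * (π / w))) + 0 := by positivity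
  rw [deltaOp_eq_lapOp_zero_add, commOp_add_left, LinearMap.comp_add]
  refine (hloc.add hnl).mono fun y y' => ?_
  have t1 := loc₂_le_loc₁ (L := L) (kk := kk) (S := ((cubeBlocks M (coverCorner M w q m₀ k) (q * w) : Finset (Tor M)) : Set (Tor M))) hθloc
    (by linarith [min_le_left δ₀ δ₁] : min δ₀ δ₁ / 2 ≤ δ₀) y y'
  refine (add_le_add t1 le_rfl).trans (le_of_eq ?_)
  simp only [unitTorusGeo]
  ring

end Cube

end Summit.QuantumFields.YangMills.BalabanUVNodes.N15.Gluing

end
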